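import Mathlib
import HarnessLib
import Literature.Analysis.FluidPDE.SuitableWeak
import Literature.Analysis.FluidPDE.LerayHopf
import Literature.Analysis.FluidPDE.BesovBlowupConcentration
import Literature.Analysis.FluidPDE.ClassicalTopPointCubic
import Literature.Analysis.FluidPDE.CKNLocalRegularityRRSPressure
import Literature.Analysis.FluidPDE.SereginSverakPressureProofs
import Literature.Analysis.FluidPDE.NSViscosityRescaling
import Literature.Analysis.FluidPDE.NSLerayHopfABCScaling
import Summits.NavierStokesRegularity.NavierStokesRegularity.Theses.QuarterJolt
import Summits.NavierStokesRegularity.NavierStokesRegularity.Theorems.QuarterJoltNoFlatCellVertexTools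
import Summits.NavierStokesRegularity.NavierStokesRegularity.Theorems.LerayQuarterDissipationRecordTimeTypeI

/-!
# Route QuarterJolt — support `NoFlatCellVertex` (stmt-NavierStokesRegularity-26465):
# a point whose scaled cell energy vanishes is not a singular vertex

Seat ns-qj-p1 g0 (director-ns g13 req142 (2)); planner of record ns-idea-9 g2 (route header §«#9 NoFlatCellVertex»,
critic idea-crit-8 V25, price P2).

THE STATEMENT (`…Theses.QuarterJolt.NoFlatCellVertex`, proved here BY NAME as `noFlatCellVertex_proof`): in the frame
(classical on `[0,T)` with viscosity `ν > 0`, Leray–Hopf on `[0,T]`, rapidly decaying datum) with the quarter slice law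
`∫|curl u(t)|² ≤ K/√(T−t)`, a point `x₀` with vanishing scaled cell energy
(`∀ ε > 0 ∃ r₀ > 0 ∀ r ∈ (0,r₀) ∀ t ∈ (T−r², T]: ∫_{B_r(x₀)}|u(t)|² ≤ ε r`) is not a singular vertex:
`¬ (∀ r > 0, r² < T → ‖u‖_{L^∞(Q_r(T,x₀))} = ∞)`.

PROOF.
1. TYPE I. `RecordTimeTypeI.main` (item 22145, landed): the slice law gives `‖u(t,x)‖ ≤ C/√(T−t)` on a window `(T₁,T)`.
2. CUBIC SMALLNESS (in place of the planner's Sobolev slices): on `Q_r(T,x₀)`,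
   `|u|³ ≤ |u|² · C/√(T−t)`, so `∫∫_{Q_r}|u|³ ≤ ε r · C · ∫_{T−r²}^T (T−t)^{−1/2} dt = 2Cε r²`, i.e.
   `C(r) = r⁻² ∫∫_{Q_r}|u|³ ≤ 2Cε`: the cubic functional `cknC` tends to `0` as `r → 0⁺`
   (`NoFlatCellVertex.tendsto_cknC_of_typeI_of_flat` in the sibling tools file `QuarterJoltNoFlatCellVertexTools`).
3. ν-NORMALISATION `w(s,y) = ν⁻¹u(s/ν,y)` on `[0, νT)` (`IsClassicalNSSolutionOn.viscosityRescale_set`,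
   `IsLerayHopfOn.viscosityRescale`; the Type-I window, the flat cell and the singular vertex are transported by
   `typeI_timeRescale`, `flat_timeRescale`, `singular_timeRescale` of the tools file).
4. ε-REGULARITY AT THE APEX (ν = 1, `core`): with the Seregin–Šverák gauged pressure
   (`isSuitableWeakSolutionOn_gauge_of_classical`, `lintegral_slab_gauged_pressure_lt_top` ⇒ `D(√T/2) < ∞`),
   `exists_cknC_add_cknD_le_of_tendsto_cknC` (pressure-decay iteration) gives one scale with `C + D` below the
   threshold of Robinson–Rodrigo–Sadowski Thm. 15.3 (`RRS2016.theorem15_3_holds`), and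
   `eLpNorm_top_lt_top_of_cknC_add_cknD_lt` bounds `w` on `Q_{r/2}(νT, x₀)` — contradicting the transported
   singular vertex.

WHAT THIS IS NOT: not a proof of Navier–Stokes regularity and not progress on the route's two OPEN cruxes
(`EnstrophyQuarterLaw` stmt-1574, `NoTerminalJolt` stmt-26463 — both consequences of regularity used toward it); it is the
unconditional M support «flat cell ⇒ regular vertex» under the slice law, by classical ε-regularity.
No summit statement is proved here. [folklore]
-/

noncomputable section

-- the summit and its single sub-problem share the name (CONVENTIONS §1), as in every Theorems file
set_option linter.dupNamespace false

namespace Summit.NavierStokesRegularity.NavierStokesRegularity.Theorems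

open MeasureTheory Set Function Filter Topology Metric
open scoped NNReal ENNReal
open Literature.Analysis.FluidPDE

namespace NoFlatCellVertex

/-! ### Step 4: ε-regularity at the apex for unit viscosity -/

/-- **The unit-viscosity core.** A classical Leray–Hopf solution `(w, q)` of the unforced system with `ν = 1` on
`ℝ³ × [0,T)`, Type I on a window `(T₁, T)`, whose scaled cell energy at `x₀` vanishes, is essentially bounded on some
parabolic cylinder `Q_ρ(T, x₀)` with `0 < ρ`, `ρ² < T` (pressure-decay iteration from `C(r) → 0` at the apex with the
Seregin–Šverák gauged pressure, then Robinson–Rodrigo–Sadowski's Thm. 15.3 up to the top). -/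
theorem core {T : ℝ} (hT : 0 < T)
    {w : ℝ → EuclideanSpace ℝ (Fin 3) → EuclideanSpace ℝ (Fin 3)} {q : ℝ → EuclideanSpace ℝ (Fin 3) → ℝ}
    (hsol : IsClassicalNSSolutionOn (Ico 0 T) 1 0 w q) (hLH : IsLerayHopfOn T 1 0 (w 0) w)
    {T₁ C : ℝ} (hT₁ : T₁ < T) (hC : 0 ≤ C)
    (hI : ∀ t ∈ Ioo T₁ T, ∀ x, ‖w t x‖ ≤ C / Real.sqrt (T - t)) {x₀ : EuclideanSpace ℝ (Fin 3)}
    (hflat : ∀ ε : ℝ, 0 < ε → ∃ r₀ : ℝ, 0 < r₀ ∧ ∀ r : ℝ, 0 < r → r < r₀ →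
      ∀ t ∈ Ioc (T - r ^ 2) T, ∫⁻ x in ball x₀ r, ‖w t x‖ₑ ^ 2 ≤ ENNReal.ofReal (ε * r)) :
    ∃ ρ : ℝ, 0 < ρ ∧ ρ ^ 2 < T ∧
      eLpNorm (uncurry w) ∞
        (volume.restrict (parabolicCylinder ρ ((T, x₀) : ℝ × EuclideanSpace ℝ (Fin 3)))) < ∞ := by
  obtain ⟨ε₁, cM, hε₁, -, H⟩ := RRS2016.theorem15_3_holds
  -- the gauged pressure and the suitable weak solution on the open slab
  set Q : TopologicalSpace.Opens (ℝ × EuclideanSpace ℝ (Fin 3)) :=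
    ⟨Ioo 0 T ×ˢ univ, isOpen_Ioo.prod isOpen_univ⟩ with hQdef
  have hQ : (Q : Set (ℝ × EuclideanSpace ℝ (Fin 3))) ⊆ Ioo 0 T ×ˢ univ := Subset.rfl
  have hsw : IsSuitableWeakSolutionOn Q 1 0 w (fun t x => q t x - (q t 0 - normalisedPressure (w t) 0)) :=
    SereginSverak2002.isSuitableWeakSolutionOn_gauge_of_classical one_pos hT hsol hLH Q hQ
  -- the scale `ρ₀ = √T/2`
  have hρ₀0 : 0 < Real.sqrt T / 2 := by positivity
  have hρ₀sq : (Real.sqrt T / 2) ^ 2 = T / 4 := by rw [div_pow, Real.sq_sqrt hT.le]; norm_num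
  have hsub : parabolicCylinder (Real.sqrt T / 2) ((T, x₀) : ℝ × EuclideanSpace ℝ (Fin 3)) ⊆
      (Q : Set (ℝ × EuclideanSpace ℝ (Fin 3))) := by
    intro z hz
    rw [mem_parabolicCylinder] at hz
    obtain ⟨⟨h1, h2⟩, -⟩ := hz
    refine ⟨⟨?_, h2⟩, mem_univ _⟩
    simp only at h1
    rw [hρ₀sq] at h1
    linarith
  -- `D(ρ₀) < ∞` for the gauged pressure
  have hD : cknD (Real.sqrt T / 2) ((T, x₀) : ℝ × EuclideanSpace ℝ (Fin 3))
      (fun t x => q t x - (q t 0 - normalisedPressure (w t) 0)) ≠ ∞ := by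
    have hslab := SereginSverak2002.lintegral_slab_gauged_pressure_lt_top one_pos hT hsol hLH
    unfold cknD
    refine ENNReal.mul_ne_top ?_ ?_
    · exact ENNReal.inv_ne_top.2 (pow_ne_zero _ (ENNReal.ofReal_pos.2 hρ₀0).ne')
    · exact (lt_of_le_of_lt (lintegral_mono_set hsub) hslab).ne
  -- `C(r) → 0`
  have hCt := tendsto_cknC_of_typeI_of_flat hT₁ hC hI hflat
  -- one scale with `C + D` below the threshold
  have hδ : (0 : ℝ≥0∞) < ENNReal.ofReal ε₁ / 2 :=
    ENNReal.div_pos (ENNReal.ofReal_pos.2 hε₁).ne' (by norm_num)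
  obtain ⟨r, ⟨hr, hrρ₀⟩, hsmall⟩ :=
    exists_cknC_add_cknD_le_of_tendsto_cknC hsw.distributional hρ₀0 hsub hD hCt hδ
  have hlt : cknC r ((T, x₀) : ℝ × EuclideanSpace ℝ (Fin 3)) w +
      cknD r ((T, x₀) : ℝ × EuclideanSpace ℝ (Fin 3))
        (fun t x => q t x - (q t 0 - normalisedPressure (w t) 0)) < ENNReal.ofReal ε₁ :=
    hsmall.trans_lt (ENNReal.half_lt_self (ENNReal.ofReal_pos.2 hε₁).ne' ENNReal.ofReal_ne_top)
  have hrT : r ^ 2 < T := by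
    have := pow_le_pow_left₀ hr.le hrρ₀ 2
    rw [hρ₀sq] at this
    linarith
  have hbd := eLpNorm_top_lt_top_of_cknC_add_cknD_lt hT hsol hLH hε₁ H hr hrT hlt
  exact ⟨r / 2, by positivity, by nlinarith, hbd⟩

/-! ### Assembly -/

/-- **NoFlatCellVertex, hypothesis form.** In the frame with viscosity `ν`, the slice law with constant `K` and a
vanishing scaled cell energy at `x₀` are incompatible with `(T, x₀)` being a singular vertex. -/
theorem main {ν T : ℝ} (hν : 0 < ν) (hT : 0 < T)
    {u : ℝ → EuclideanSpace ℝ (Fin 3) → EuclideanSpace ℝ (Fin 3)} {p : ℝ → EuclideanSpace ℝ (Fin 3) → ℝ}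
    (hsol : IsClassicalNSSolutionOn (Ico 0 T) ν 0 u p) (hLH : IsLerayHopfOn T ν 0 (u 0) u)
    (hdec : HasRapidSpatialDecay (u 0)) (K : ℝ)
    (hK : ∀ t ∈ Ico 0 T, ∫⁻ x, ‖curl (u t) x‖ₑ ^ 2 ≤ ENNReal.ofReal (K / Real.sqrt (T - t)))
    (x₀ : EuclideanSpace ℝ (Fin 3))
    (hflat : ∀ ε : ℝ, 0 < ε → ∃ r₀ : ℝ, 0 < r₀ ∧ ∀ r : ℝ, 0 < r → r < r₀ →
      ∀ t ∈ Ioc (T - r ^ 2) T, ∫⁻ x in ball x₀ r, ‖u t x‖ₑ ^ 2 ≤ ENNReal.ofReal (ε * r))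
    (hsing : ∀ r : ℝ, 0 < r → r ^ 2 < T →
      eLpNorm (uncurry u) ⊤
        (volume.restrict (parabolicCylinder r ((T : ℝ), x₀))) = ⊤) : False := by
  -- Step 1: the Type-I window
  obtain ⟨C, hC⟩ := RecordTimeTypeI.main hν hT hsol hLH hdec K hK
  obtain ⟨T₁, hT₁T, hT₁⟩ := mem_nhdsLT_iff_exists_Ioo_subset.1 hC
  have hT₁T' : T₁ < T := hT₁T
  have hI : ∀ t ∈ Ioo T₁ T, ∀ x, ‖u t x‖ ≤ C / Real.sqrt (T - t) := fun t ht => hT₁ ht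
  have hC0 : 0 ≤ C := by
    obtain ⟨t, ht⟩ := nonempty_Ioo.2 hT₁T'
    have h := hI t ht x₀
    have hsq : 0 < Real.sqrt (T - t) := Real.sqrt_pos.2 (sub_pos.2 ht.2)
    by_contra hneg
    rw [not_le] at hneg
    have : C / Real.sqrt (T - t) < 0 := div_neg_of_neg_of_pos hneg hsq
    linarith [norm_nonneg (u t x₀)]
  -- Step 3: the ν-normalisation
  have hνT : 0 < ν * T := mul_pos hν hT
  have hsol' : IsClassicalNSSolutionOn (Ico 0 (ν * T)) 1 0 (timeRescale ν⁻¹ ν⁻¹ u)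
      (timeRescale ν⁻¹ (ν⁻¹ ^ 2) p) := by
    have hmaps : MapsTo (fun τ => ν⁻¹ * τ) (Ico 0 (ν * T)) (Ico 0 T) := by
      intro τ hτ
      refine ⟨by have := hτ.1; positivity, ?_⟩
      rw [inv_mul_lt_iff₀ hν]
      exact hτ.2
    have h := hsol.viscosityRescale_set hν.ne' hmaps (uniqueDiffOn_Ico 0 (ν * T))
    rwa [timeRescale_zero_force] at h
  have hLH' : IsLerayHopfOn (ν * T) 1 0 (timeRescale ν⁻¹ ν⁻¹ u 0) (timeRescale ν⁻¹ ν⁻¹ u) := by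
    have h := hLH.viscosityRescale (c := ν⁻¹) (inv_pos.2 hν)
    have e1 : T / ν⁻¹ = ν * T := by rw [div_inv_eq_mul, mul_comm]
    have e2 : ν⁻¹ * ν = 1 := inv_mul_cancel₀ hν.ne'
    have e3 : timeRescale ν⁻¹ (ν⁻¹ ^ 2)
        (0 : ℝ → (EuclideanSpace ℝ (Fin 3)) → (EuclideanSpace ℝ (Fin 3))) = 0 :=
      timeRescale_zero_force _ _
    have e4 : ν⁻¹ • u 0 = timeRescale ν⁻¹ ν⁻¹ u 0 := by
      funext x
      rw [timeRescale_apply, mul_zero, Pi.smul_apply]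
    rw [e1, e2, e3, e4] at h
    exact h
  have hI' := typeI_timeRescale hν hI
  have hflat' := flat_timeRescale hν (T := T) hflat
  -- Step 4 at unit viscosity, and the contradiction with the transported singular vertex
  obtain ⟨ρ, hρ, hρT, hfin⟩ := core hνT hsol' hLH' (mul_lt_mul_of_pos_left hT₁T' hν)
    (by positivity : 0 ≤ C / Real.sqrt ν) hI' hflat'
  exact hfin.ne (singular_timeRescale hν hsing hρ hρT)

end NoFlatCellVertex

open NoFlatCellVertex in
/-- **Item stmt-NavierStokesRegularity-26465** (`QuarterJolt.NoFlatCellVertex`), BY NAME: in the frame (classical on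
`[0,T)` with viscosity `ν > 0`, Leray–Hopf on `[0,T]`, rapidly decaying datum) with the quarter slice law, a point
`x₀` whose scaled cell energy vanishes is not a singular vertex of `u` at time `T`.  Type I from the slice law
(`RecordTimeTypeI.main`), `C(r) → 0` from `|u|³ ≤ |u|²·C/√(T−t)`, ν-normalisation, pressure-decay iteration and
Robinson–Rodrigo–Sadowski's ε-regularity theorem at the apex.  An unconditional support; nothing about NS regularity
is asserted (the cruxes `EnstrophyQuarterLaw`, `NoTerminalJolt` stay open). [folklore] -/
theorem noFlatCellVertex_proof :
    Summit.NavierStokesRegularity.NavierStokesRegularity.Theses.QuarterJolt.NoFlatCellVertex := by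
  unfold Summit.NavierStokesRegularity.NavierStokesRegularity.Theses.QuarterJolt.NoFlatCellVertex
  intro ν T hν hT u p hsol hLH hdec K hK x₀ hflat hsing
  exact main hν hT hsol hLH hdec K hK x₀ hflat hsing

end Summit.NavierStokesRegularity.NavierStokesRegularity.Theorems

end
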